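/-
Origin: expansion seat `planner-pub-hodgecm-pv05-g5-0`, handover #2 2026-08-18T08:53:16Z (`HOME/pub-hodgecm-pv05-g5/lean/Pv05g5/FockHermiteDict.lean`, md5 8c021ac2, 147 lines);
landed by the gen-7 packager in gate run 27 as `HodgeCM/PerL34/FockHermiteDict.lean` (import ^import Pv05g5\.→import HodgeCM.PerL34. ×1).
-/
/-
Copyright (c) 2026. Released under the Apache-2.0 license.
-/
import Summits.HodgeConjecture.HodgeCM.PerL34.FockPrintDictionary_4
import Summits.HodgeConjecture.HodgeCM.PerL34.FockHermite_3

/-!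
# Junction: Adams's printed Fock letters `mz, dz, adK, adPplus, adPminus` ↦ Folland's `Z^*, Z` on the Hermite span

This leaf joins BY NAME the two kernel dictionaries of seam **S4**:

* `HodgeCM.PerL34.Fock.PrintDict` (`FockPrintDictionary`): Adams's oscillator letters on the Fock side `ℂ[z_σ]` —
  `mz i = (z_i ·)`, `dz j = ∂/∂z_j`, `adK i j = z_i ∂_j + ½δ_{ij}` (`𝔨`), `adPplus i j = z_i z_j` (`𝔭⁺`),
  `adPminus i j = ∂_i ∂_j` (`𝔭⁻`), with `ccr : [∂_j, z_i] = δ_{ij}`;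
* `HodgeCM.PerL34.Fock.Hermite` (`FockHermite`): Folland's `Z_j, Z_j^*, 2π(D_j²+X_j²)` on the symbols of the Hermite
  span `{p(x)e^{−πx²}}` ⊂ functions on `ℝ^σ`, and the polynomial inverse Bargmann transform
  `binv = B⁻¹|_{ℂ[z_σ]}` / `bargmannInv : ℂ[z_σ] ≃ₗ[ℂ] ℂ[x_σ]` ([Fo89 (1.73)–(1.75), (1.81)]).

KERNEL content (Mathlib + the two files; zero cited facts, zero hypotheses): `B⁻¹` intertwines
`mz j` with `Z_j^*` and `dz j` with `π Z_j` ([Fo89 §1.7, chunk p0045 L49]: "`Z_j = π^{−1/2}B⁻¹A_jB`,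
`Z_j^* = π^{−1/2}B⁻¹A_j^*B`" combined with [Fo89 (1.74), (1.75)]: "`A_j F = (1/√π) ∂F/∂z_j`", "`A_j^* F = √π z_j F`"),
hence carries Adams's three quadratic families to members of Folland's family
"`{Z_j Z_k, Z_j^* Z_k, Z_j Z_k^*, Z_j^* Z_k^*}`" of [Fo89 (4.49) Proposition; chunk p0166 L34–L36]:
`𝔭⁺ ↦ Z_i^* Z_j^*`, `𝔭⁻ ↦ π² Z_i Z_j`, `𝔨 ↦ π Z_i^* Z_j + ½δ_{ij}`, the diagonal of the last being one half of the
Hermite operator `2π(D_j² + X_j²)` whose eigenvectors are the `h_α` ((1.83a)).  Stated both as intertwining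
identities `binv ∘ T = T' ∘ binv` and as conjugations `B⁻¹ T B = T'` through the isomorphism `bargmannInv`.

PRINT residual: unchanged from `FockHermite` — (P1a) §1.7 (vii), (P1b) unitarity of `B`, (P1c) Thm (4.45) +
Prop. (4.49); nothing of it is used here.
-/

set_option autoImplicit false

open MvPolynomial Complex
open scoped Real

namespace HodgeCM.PerL34.Fock.Hermite

noncomputable section

variable {σ : Type*} [Fintype σ] [DecidableEq σ]

/-- `B⁻¹ ∘ (z_j ·) = Z_j^* ∘ B⁻¹` ([Fo89 (1.73) + (1.75)], by name against `PrintDict.mz`). -/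
theorem binv_comp_mz (j : σ) : binv ∘ₗ PrintDict.mz j = opZs j ∘ₗ binv (σ := σ) := by
  apply LinearMap.ext; intro F
  simp only [LinearMap.comp_apply, PrintDict.mz_apply, binv_X_mul]

/-- `B⁻¹ ∘ ∂/∂z_j = π Z_j ∘ B⁻¹` ([Fo89 (1.73) + (1.74)], by name against `PrintDict.dz`). -/
theorem binv_comp_dz (j : σ) : binv ∘ₗ PrintDict.dz j = (π : ℂ) • (opZ j ∘ₗ binv (σ := σ)) := by
  have hπ := pi_ne_zero'
  apply LinearMap.ext; intro F
  simp only [LinearMap.comp_apply, LinearMap.smul_apply, PrintDict.dz_apply, opZ_binv, smul_smul,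
    mul_inv_cancel₀ hπ, one_smul]

/-- The CCR match: Adams's `[∂_j, z_i] = δ_{ij}` (`PrintDict.ccr`) is carried by `B⁻¹` to Folland's
`[Z_j, Z_i^*] = π⁻¹ δ_{ji}` (`opZ_opZs`) — here as the transported identity on `B⁻¹ F`. -/
theorem binv_ccr (i j : σ) (F : MvPolynomial σ ℂ) :
    binv ((PrintDict.dz j * PrintDict.mz i) F) =
      (π : ℂ) • opZs i (opZ j (binv F)) + (if i = j then binv F else 0) := by
  have hπ := pi_ne_zero'
  rw [PrintDict.ccr, LinearMap.add_apply, map_add, Module.End.mul_apply, PrintDict.mz_apply, PrintDict.dz_apply,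
    binv_X_mul, opZ_binv, map_smul, smul_smul, mul_inv_cancel₀ hπ, one_smul]
  by_cases h : i = j
  · simp [h]
  · simp [h]

/-- `𝔭⁺`: `B⁻¹ ∘ (z_i z_j ·) = Z_i^* Z_j^* ∘ B⁻¹` (by name against `PrintDict.adPplus`). -/
theorem binv_comp_adPplus (i j : σ) :
    binv ∘ₗ PrintDict.adPplus i j = (opZs i * opZs j) ∘ₗ binv (σ := σ) := by
  apply LinearMap.ext; intro F
  simp only [LinearMap.comp_apply, PrintDict.adPplus, Module.End.mul_apply, PrintDict.mz_apply, binv_zz]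

/-- `𝔭⁻`: `B⁻¹ ∘ ∂_i∂_j = π² Z_i Z_j ∘ B⁻¹` (by name against `PrintDict.adPminus`). -/
theorem binv_comp_adPminus (i j : σ) :
    binv ∘ₗ PrintDict.adPminus i j = ((π : ℂ) ^ 2 • (opZ i * opZ j)) ∘ₗ binv (σ := σ) := by
  apply LinearMap.ext; intro F
  simp only [LinearMap.comp_apply, PrintDict.adPminus, Module.End.mul_apply, PrintDict.dz_apply, binv_dd,
    LinearMap.smul_apply]

/-- `𝔨`: `B⁻¹ ∘ (z_i ∂_j + ½δ_{ij}) = (π Z_i^* Z_j + ½δ_{ij}) ∘ B⁻¹` (by name against `PrintDict.adK`). -/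
theorem binv_comp_adK (i j : σ) :
    binv ∘ₗ PrintDict.adK i j =
      ((π : ℂ) • (opZs i * opZ j) + (1 / 2 : ℂ) • (if i = j then 1 else 0)) ∘ₗ binv (σ := σ) := by
  have hπ := pi_ne_zero'
  apply LinearMap.ext; intro F
  simp only [LinearMap.comp_apply, PrintDict.adK, LinearMap.add_apply, LinearMap.smul_apply, Module.End.mul_apply,
    PrintDict.mz_apply, PrintDict.dz_apply, map_add, map_smul, binv_X_mul, opZ_binv, smul_smul, mul_inv_cancel₀ hπ,
    one_smul]
  split_ifs <;> simp

/-- The diagonal `𝔨`-letter is one half of the Hermite operator: `B⁻¹ ∘ (z_j ∂_j + ½) = ½ · 2π(D_j² + X_j²) ∘ B⁻¹`,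
so by (1.83a) `B⁻¹` carries its eigenvectors `z^α` (eigenvalue `α_j + ½`) to the Hermite functions. -/
theorem binv_comp_adK_self (j : σ) :
    binv ∘ₗ PrintDict.adK j j = ((1 / 2 : ℂ) • hermiteOp j) ∘ₗ binv (σ := σ) := by
  apply LinearMap.ext; intro F
  have h := binv_euler_half j F
  simp only [LinearMap.comp_apply, PrintDict.adK, LinearMap.add_apply, LinearMap.smul_apply,
    Module.End.mul_apply, PrintDict.mz_apply, PrintDict.dz_apply]
  exact h

/-- (1.83a) read on the Fock side through the junction: `(z_j ∂_j + ½) ζ_α = (α_j + ½) ζ_α` transported IS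
`½ · 2π(D_j² + X_j²) h_α = (α_j + ½) h_α`. -/
theorem adK_self_herm (j : σ) (α : σ →₀ ℕ) :
    binv (PrintDict.adK j j (zeta α)) = ((α j : ℂ) + 1 / 2) • herm (σ := σ) α := by
  have h := congrArg (fun f => f (zeta (σ := σ) α)) (binv_comp_adK_self (σ := σ) j)
  simp only [LinearMap.comp_apply, LinearMap.smul_apply] at h
  rw [h, ← herm, hermiteOp_herm, smul_smul]
  congr 1
  ring

/-! ### Conjugation form through the isomorphism `bargmannInv : ℂ[z_σ] ≃ₗ[ℂ] ℂ[x_σ]` -/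

/-- `B⁻¹ (z_j ·) B = Z_j^*` on the Hermite span. -/
theorem conj_mz (j : σ) :
    (bargmannInv (σ := σ)).toLinearMap ∘ₗ PrintDict.mz j ∘ₗ (bargmannInv (σ := σ)).symm.toLinearMap = opZs j := by
  apply LinearMap.ext; intro p
  obtain ⟨F, rfl⟩ := binv_surjective p
  simp only [LinearMap.comp_apply, LinearEquiv.coe_toLinearMap, PrintDict.mz_apply]
  rw [show (bargmannInv (σ := σ)).symm (binv F) = F from (bargmannInv (σ := σ)).symm_apply_apply F,
    bargmannInv_apply, binv_X_mul]

/-- `B⁻¹ (∂/∂z_j) B = π Z_j` on the Hermite span. -/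
theorem conj_dz (j : σ) :
    (bargmannInv (σ := σ)).toLinearMap ∘ₗ PrintDict.dz j ∘ₗ (bargmannInv (σ := σ)).symm.toLinearMap =
      (π : ℂ) • opZ j := by
  have hπ := pi_ne_zero'
  apply LinearMap.ext; intro p
  obtain ⟨F, rfl⟩ := binv_surjective p
  simp only [LinearMap.comp_apply, LinearEquiv.coe_toLinearMap, PrintDict.dz_apply, LinearMap.smul_apply]
  rw [show (bargmannInv (σ := σ)).symm (binv F) = F from (bargmannInv (σ := σ)).symm_apply_apply F,
    bargmannInv_apply, opZ_binv, smul_smul, mul_inv_cancel₀ hπ, one_smul]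

/-- `B⁻¹ (z_j ∂_j + ½) B = ½ · 2π(D_j² + X_j²)`: the diagonal compact letter IS (half) the Hermite operator. -/
theorem conj_adK_self (j : σ) :
    (bargmannInv (σ := σ)).toLinearMap ∘ₗ PrintDict.adK j j ∘ₗ (bargmannInv (σ := σ)).symm.toLinearMap =
      (1 / 2 : ℂ) • hermiteOp j := by
  apply LinearMap.ext; intro p
  obtain ⟨F, rfl⟩ := binv_surjective p
  have h := congrArg (fun f => f F) (binv_comp_adK_self (σ := σ) j)
  simp only [LinearMap.comp_apply, LinearMap.smul_apply] at h
  simp only [LinearMap.comp_apply, LinearEquiv.coe_toLinearMap, LinearMap.smul_apply]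
  rw [show (bargmannInv (σ := σ)).symm (binv F) = F from (bargmannInv (σ := σ)).symm_apply_apply F,
    bargmannInv_apply, h]

end

end HodgeCM.PerL34.Fock.Hermite
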